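import Summits.ABC.IUTFork.Conditional.FreyLegendreP6Engine
import Summits.ABC.IUTFork.Conditional.AbcOfSHwindowFreyRefutationP6Tier2
import Literature.NumberTheory.EllipticCurves.PointCountEulerCriterion
import Literature.NumberTheory.EllipticCurves.ComplexMultiplicationLocalFactorsAux
import HarnessLib

/-!
# (P6) at the REYSSAT Frey–Legendre datum `λ = 2/23⁵` (`2 + 3¹⁰·109 = 23⁵`), every `l` of the Reyssat K/M rows — IN KERNEL

PROOF-ONLY file (D-0012; 0 definitions, 0 `Prop` facts, no instance, no notation) of the abc-iut cell (seat abc-iut-w6-d102,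
gen 5; row «C:P6-ENGINE-REYSSAT» = ruling C-R69 (2) / C-R69′ (γ) of the C lead abc-iut-plan g10, 2026-08-27T00:54:47Z:
«C-R66 (b)'s engine GO EXTENDS to the Reyssat Frey datum»). The M-window socket instance
`Conditional.not_hSHwBad_M_of_reyssat_thirteen_inputs` (abc-iut-W-num-6, `AbcOfSHwBadMOfRefutedReyssat.lean`, p479897) takes
`hc6 : Cor22.CondP6 (ratPoint (((2 : ℕ) : ℚ) / (23 ^ 5 : ℕ))) 13` AS A NAMED INPUT, and the R-W table carries a column
`status_(P6)` at every Reyssat pair `(2/23⁵, l)`, `l ∈ {13, 17, 19}` (`GenuineM.not_pilotKummerCompatHull_reyssat_le_19_rad`,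
p477727; K twin p466042) and `l ∈ {29, 31, …, 149}` (`…_reyssat_of_le_149_rad`). Here EVERY ONE of these 28 (P6) statements is a
THEOREM, by the datum-parametric engine `FreyP6Engine.condP6_ratPoint_of_certificate` (p477940) at `a = 2`, `c = 23⁵`:

* the integer model `E₁ = [0, −(c²+ac), 0, ac³, 0]` of `y² = x(x−1)(x−λ)`; `Δ(E₁) = 16a²c⁸(c−a)² = 2⁶·3²⁰·23⁴⁰·109²`,
  `c₄(E₁) = 16c²(c²−ac+a²) ≡ 38 (mod 109)`: the MULTIPLICATIVE prime is `q = 109` with `k = ord₁₀₉ Δ(E₁) = 2` (`l ∤ 2`);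
* Mazur's Frobenius certificate at ONE good prime `p ∈ {7, 19, 41}` per `l` (`{7, 19, 41}` is a minimal cover of the 28 values of
  `l`; no cover by primes `≤ 19` exists — `l = 137` needs `p ∈ {31, 41, 47, 59, …}`):
  `E₁ mod 7 = [0,4,0,2,0]`, `#Ẽ₁(𝔽₇) = 8`, `a₇ = 0`, `X² + 7` rootless mod `l ∈ {13,17,19,31,41,47,59,61,73,83,89,97,101,103,131,139}`;
  `E₁ mod 19 = [0,0,0,3,0]`, `#Ẽ₁(𝔽₁₉) = 20`, `a₁₉ = 0`, `X² + 19` rootless mod `l ∈ {29,37,53,67,71,79,107,113,127}`;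
  `E₁ mod 41 = [0,1,0,39,0]`, `#Ẽ₁(𝔽₄₁) = 40`, `a₄₁ = 2`, `X² − 2X + 41` rootless mod `l ∈ {43,137,149}`;
  each point count is a KERNEL computation (Euler's criterion, `card_sol_eq_sum_euler` / `natCard_point_eq_one_add_card`), each
  rootlessness a `decide`, each divisibility a `norm_num`;
* transport UP to every theta-field: `l ∤ 46080` for all 28 `l` (inside the engine).

K2 (C-R66 (c), two independent computations posted BEFORE typing): source #2 = abc-iut-C-lit g6 STATUS 2026-08-27T00:59:41Z (PARI/GP
kit job j263705 `ellap`/`ellglobalred` + desk brute force: `p = 7: 8, 0`; `p = 19: disc −76`; `p = 5/11/13/17/29/37` concordant;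
`q = 109, k = 2`; `c₄(E₁) ≢ 0 mod 3, 109`); source #1 = this seat's in-seat count, STATUS 2026-08-27T01:2xZ «ARRIVED + CLAIM … K2 MY
IN-SEAT SOURCE» (two code paths — `y`-enumeration and Euler-criterion column sum — identical: `p = 7: 8, 0 · 19: 20, 0 · 41: 40, 2`, all
fifteen `p ≤ 61` listed). The kernel's `decide` is the arbiter of every number below.

HONEST SCOPE: classical, undisputed arithmetic of ONE elliptic curve over `ℚ` (Serre 1972 / Mazur 1978 / a Tate transvection); it turns
the named input `hc6` of p479897 (and the (P6) inputs of its `l = 17, 19, 29, …, 149` siblings, when typed) into theorems, nothing more;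
nothing here is about Θ-data; refuted-modulo-inputs ≠ refuted for what those sockets conclude; no side taken on [IUTchIII] Cor. 3.12 or
on any author; typed ≠ proved for every IUT sentence; no abc claim.
[cite: Mochizuki2012, IUTchIV Cor. 2.2 (ii) proof (P6) p. 46; IUTchI Def. 3.1 (c) p. 62] [cite: Mazur1978, §6 Prop. 6.3 (1) p. 153]
[cite: MochizukiGenEll2010, Lem. 3.1 (iii) p. 14] [cite: SilvermanAEC2009, VII.5 Prop. 5.1(b), III.1 Table 3.1]
[claim: Mochizuki2012, status: disputed] for every IUT quotation.
-/

noncomputable section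

open scoped Classical
open WeierstrassCurve

namespace Summit.ABC.IUTFork.Conditional

namespace FreyP6Reyssat

open Literature.NumberTheory.EllipticCurves Literature.NumberTheory.DiophantineGeometry.GenEll
open Literature.NumberTheory.DiophantineGeometry Literature.IUT.LogVolume

/-! ## §1 The model `E₁ = [0, −(c²+ac), 0, ac³, 0]`, `a = 2`, `c = 23⁵`: the multiplicative prime `109` -/

/-- `109 ∤ c₄(E₁)` (`c₄ = 16c²(c²−2c+4)`, `c ≡ 2 (mod 109)`, so `c₄ ≡ 16·4·4 ≢ 0`). [cite: SilvermanAEC2009, VII.5 Prop. 5.1(b)] -/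
theorem not_dvd_c₄_109 : ¬ ((109 : ℕ) : ℤ) ∣
    ((⟨0, -(((23 ^ 5 : ℕ) : ℤ) ^ 2 + (2 : ℕ) * (23 ^ 5 : ℕ)), 0, ((2 : ℕ) : ℤ) * ((23 ^ 5 : ℕ) : ℤ) ^ 3, 0⟩ :
      WeierstrassCurve ℤ)).c₄ := by
  rw [FreyP6Engine.c₄_model]; norm_num

/-- `Δ(E₁) = 109² · D` with `D = 16·2²·c⁸·(3¹⁰)²` (`c − a = 3¹⁰·109`). [cite: SilvermanAEC2009, III.1 Table 3.1] -/
theorem Δ_eq_109 :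
    ((⟨0, -(((23 ^ 5 : ℕ) : ℤ) ^ 2 + (2 : ℕ) * (23 ^ 5 : ℕ)), 0, ((2 : ℕ) : ℤ) * ((23 ^ 5 : ℕ) : ℤ) ^ 3, 0⟩ :
      WeierstrassCurve ℤ)).Δ = (109 : ℕ) ^ 2 * (16 * 2 ^ 2 * ((23 ^ 5 : ℕ) : ℤ) ^ 8 * (3 ^ 10) ^ 2) := by
  rw [FreyP6Engine.Δ_model]; norm_num

/-- `109 ∤ D`. [folklore] -/
theorem not_dvd_D_109 : ¬ ((109 : ℕ) : ℤ) ∣ (16 * 2 ^ 2 * ((23 ^ 5 : ℕ) : ℤ) ^ 8 * (3 ^ 10) ^ 2) := by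
  norm_num

/-! ## §2 Frobenius certificates at the good primes `7`, `19`, `41` (kernel point counts) -/

/-- `E₁ mod 7 = [0, 4, 0, 2, 0]`. [folklore] -/
theorem model_map_7 :
    (⟨0, -(((23 ^ 5 : ℕ) : ℤ) ^ 2 + (2 : ℕ) * (23 ^ 5 : ℕ)), 0, ((2 : ℕ) : ℤ) * ((23 ^ 5 : ℕ) : ℤ) ^ 3, 0⟩ :
      WeierstrassCurve ℤ).map (Int.castRingHom (ZMod 7)) = ⟨0, 4, 0, 2, 0⟩ := by
  ext <;> decide +kernel

/-- `#Ẽ₁(𝔽₇) = 8` (kernel count, Euler's criterion). [folklore] -/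
theorem natCard_point_7 : Nat.card (⟨0, 4, 0, 2, 0⟩ : WeierstrassCurve (ZMod 7)).toAffine.Point = 8 := by
  rw [@WeierstrassCurve.natCard_point_eq_one_add_card (ZMod 7) (@ZMod.instField 7 ⟨by norm_num⟩) _ _ _
    (by decide +kernel), @card_sol_eq_sum_euler (ZMod 7) (@ZMod.instField 7 ⟨by norm_num⟩) _ _
    (by rw [ZMod.ringChar_zmod_n]; decide)]
  decide +kernel

/-- `a₇(E₁) = 7 + 1 − 8 = 0`. [folklore] -/
theorem frobeniusTrace_7 : Literature.NumberTheory.Automorphic.frobeniusTrace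
    (⟨0, -(((23 ^ 5 : ℕ) : ℤ) ^ 2 + (2 : ℕ) * (23 ^ 5 : ℕ)), 0, ((2 : ℕ) : ℤ) * ((23 ^ 5 : ℕ) : ℤ) ^ 3, 0⟩ :
      WeierstrassCurve ℤ) 7 = 0 := by
  rw [Literature.NumberTheory.Automorphic.frobeniusTrace, Literature.NumberTheory.Automorphic.numPointsMod,
    model_map_7, natCard_point_7]; norm_num

/-- `7 ∤ Δ(E₁)` (`7` is a good prime). [folklore] -/
theorem not_dvd_Δ_7 : ¬ ((7 : ℕ) : ℤ) ∣
    ((⟨0, -(((23 ^ 5 : ℕ) : ℤ) ^ 2 + (2 : ℕ) * (23 ^ 5 : ℕ)), 0, ((2 : ℕ) : ℤ) * ((23 ^ 5 : ℕ) : ℤ) ^ 3, 0⟩ :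
      WeierstrassCurve ℤ)).Δ := by
  rw [FreyP6Engine.Δ_model]; norm_num

/-- `E₁ mod 19 = [0, 0, 0, 3, 0]`. [folklore] -/
theorem model_map_19 :
    (⟨0, -(((23 ^ 5 : ℕ) : ℤ) ^ 2 + (2 : ℕ) * (23 ^ 5 : ℕ)), 0, ((2 : ℕ) : ℤ) * ((23 ^ 5 : ℕ) : ℤ) ^ 3, 0⟩ :
      WeierstrassCurve ℤ).map (Int.castRingHom (ZMod 19)) = ⟨0, 0, 0, 3, 0⟩ := by
  ext <;> decide +kernel

/-- `#Ẽ₁(𝔽₁₉) = 20` (kernel count, Euler's criterion). [folklore] -/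
theorem natCard_point_19 : Nat.card (⟨0, 0, 0, 3, 0⟩ : WeierstrassCurve (ZMod 19)).toAffine.Point = 20 := by
  rw [@WeierstrassCurve.natCard_point_eq_one_add_card (ZMod 19) (@ZMod.instField 19 ⟨by norm_num⟩) _ _ _
    (by decide +kernel), @card_sol_eq_sum_euler (ZMod 19) (@ZMod.instField 19 ⟨by norm_num⟩) _ _
    (by rw [ZMod.ringChar_zmod_n]; decide)]
  decide +kernel

/-- `a₁₉(E₁) = 19 + 1 − 20 = 0`. [folklore] -/
theorem frobeniusTrace_19 : Literature.NumberTheory.Automorphic.frobeniusTrace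
    (⟨0, -(((23 ^ 5 : ℕ) : ℤ) ^ 2 + (2 : ℕ) * (23 ^ 5 : ℕ)), 0, ((2 : ℕ) : ℤ) * ((23 ^ 5 : ℕ) : ℤ) ^ 3, 0⟩ :
      WeierstrassCurve ℤ) 19 = 0 := by
  rw [Literature.NumberTheory.Automorphic.frobeniusTrace, Literature.NumberTheory.Automorphic.numPointsMod,
    model_map_19, natCard_point_19]; norm_num

/-- `19 ∤ Δ(E₁)` (`19` is a good prime). [folklore] -/
theorem not_dvd_Δ_19 : ¬ ((19 : ℕ) : ℤ) ∣
    ((⟨0, -(((23 ^ 5 : ℕ) : ℤ) ^ 2 + (2 : ℕ) * (23 ^ 5 : ℕ)), 0, ((2 : ℕ) : ℤ) * ((23 ^ 5 : ℕ) : ℤ) ^ 3, 0⟩ :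
      WeierstrassCurve ℤ)).Δ := by
  rw [FreyP6Engine.Δ_model]; norm_num

/-- `E₁ mod 41 = [0, 1, 0, 39, 0]`. [folklore] -/
theorem model_map_41 :
    (⟨0, -(((23 ^ 5 : ℕ) : ℤ) ^ 2 + (2 : ℕ) * (23 ^ 5 : ℕ)), 0, ((2 : ℕ) : ℤ) * ((23 ^ 5 : ℕ) : ℤ) ^ 3, 0⟩ :
      WeierstrassCurve ℤ).map (Int.castRingHom (ZMod 41)) = ⟨0, 1, 0, 39, 0⟩ := by
  ext <;> decide +kernel

/-- `#Ẽ₁(𝔽₄₁) = 40` (kernel count, Euler's criterion). [folklore] -/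
theorem natCard_point_41 : Nat.card (⟨0, 1, 0, 39, 0⟩ : WeierstrassCurve (ZMod 41)).toAffine.Point = 40 := by
  rw [@WeierstrassCurve.natCard_point_eq_one_add_card (ZMod 41) (@ZMod.instField 41 ⟨by norm_num⟩) _ _ _
    (by decide +kernel), @card_sol_eq_sum_euler (ZMod 41) (@ZMod.instField 41 ⟨by norm_num⟩) _ _
    (by rw [ZMod.ringChar_zmod_n]; decide)]
  decide +kernel

/-- `a₄₁(E₁) = 41 + 1 − 40 = 2`. [folklore] -/
theorem frobeniusTrace_41 : Literature.NumberTheory.Automorphic.frobeniusTrace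
    (⟨0, -(((23 ^ 5 : ℕ) : ℤ) ^ 2 + (2 : ℕ) * (23 ^ 5 : ℕ)), 0, ((2 : ℕ) : ℤ) * ((23 ^ 5 : ℕ) : ℤ) ^ 3, 0⟩ :
      WeierstrassCurve ℤ) 41 = 2 := by
  rw [Literature.NumberTheory.Automorphic.frobeniusTrace, Literature.NumberTheory.Automorphic.numPointsMod,
    model_map_41, natCard_point_41]; norm_num

/-- `41 ∤ Δ(E₁)` (`41` is a good prime). [folklore] -/
theorem not_dvd_Δ_41 : ¬ ((41 : ℕ) : ℤ) ∣
    ((⟨0, -(((23 ^ 5 : ℕ) : ℤ) ^ 2 + (2 : ℕ) * (23 ^ 5 : ℕ)), 0, ((2 : ℕ) : ℤ) * ((23 ^ 5 : ℕ) : ℤ) ^ 3, 0⟩ :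
      WeierstrassCurve ℤ)).Δ := by
  rw [FreyP6Engine.Δ_model]; norm_num

/-! ## §3 The engine at the Reyssat datum: (P6) from ONE Frobenius certificate -/

/-- **(P6) at `ratPoint (2/23⁵)` from a Frobenius certificate**: for a prime `l ∤ 46080`, `109 ∤ l`, `l ∤ 2`, and a good prime
`p ≠ l` of `E₁` with `X² − a_pX + p` rootless mod `l`, `Cor22.CondP6 (ratPoint (2/23⁵)) l` — the engine
`FreyP6Engine.condP6_ratPoint_of_certificate` with the multiplicative prime `q = 109`, `k = 2`.
[cite: Mochizuki2012, IUTchIV Cor. 2.2 (ii) (P6) p.46] [cite: Mazur1978, §6 Prop. 6.3 (1) (p. 153)] -/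
theorem condP6_of_certificate (l : ℕ) [Fact l.Prime] (h46080 : ¬ l ∣ 46080) (h109 : ¬ 109 ∣ l) (hl2 : ¬ l ∣ 2)
    (p : ℕ) [Fact p.Prime] (hpl : p ≠ l)
    (hpΔ : ¬ (p : ℤ) ∣ ((⟨0, -(((23 ^ 5 : ℕ) : ℤ) ^ 2 + (2 : ℕ) * (23 ^ 5 : ℕ)), 0, ((2 : ℕ) : ℤ) * ((23 ^ 5 : ℕ) : ℤ) ^ 3, 0⟩ :
      WeierstrassCurve ℤ)).Δ)
    (hnoroot : ∀ t : ZMod l, t ^ 2 - (Literature.NumberTheory.Automorphic.frobeniusTrace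
        (⟨0, -(((23 ^ 5 : ℕ) : ℤ) ^ 2 + (2 : ℕ) * (23 ^ 5 : ℕ)), 0, ((2 : ℕ) : ℤ) * ((23 ^ 5 : ℕ) : ℤ) ^ 3, 0⟩ :
          WeierstrassCurve ℤ) p : ZMod l) * t + (p : ZMod l) ≠ 0) :
    Cor22.CondP6 (ratPoint (((2 : ℕ) : ℚ) / (23 ^ 5 : ℕ))) l :=
  FreyP6Engine.condP6_ratPoint_of_certificate 2 (23 ^ 5) (by norm_num) (by norm_num) (by norm_num) l h46080 p hpl hpΔ
    hnoroot 109 (by norm_num) h109 not_dvd_c₄_109 2 (by norm_num) hl2 _ Δ_eq_109 not_dvd_D_109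

/-! ## §4 The three `l` of the M socket p479897 / the `…_reyssat_le_19` rows: `l = 13, 17, 19` (certificate `p = 7`)

The rootlessness of `X² + 7` mod `13 / 17 / 19` is W-ref-3's `FreyRef.frey1061_noroot_13/17/19` (p478172: the datum `λ_1061` has the
same certificate prime `7` with `a₇ = 0`), reused BY NAME. -/

/-- **(P6) HOLDS at `(ratPoint (2/23⁵), 13)`** — the named input `hc6` of `Conditional.not_hSHwBad_M_of_reyssat_thirteen_inputs`
(p479897) is a theorem (certificate `p = 7`, `a₇ = 0`; multiplicative prime `109`, `ord₁₀₉ Δ = 2`).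
[cite: Mochizuki2012, IUTchIV Cor. 2.2 (ii) (P6) p.46] -/
theorem condP6_thirteen : Cor22.CondP6 (ratPoint (((2 : ℕ) : ℚ) / (23 ^ 5 : ℕ))) 13 := by
  haveI : Fact (Nat.Prime 13) := ⟨by norm_num⟩
  haveI : Fact (Nat.Prime 7) := ⟨by norm_num⟩
  refine condP6_of_certificate 13 (by norm_num) (by norm_num) (by norm_num) 7 (by norm_num) not_dvd_Δ_7 ?_
  rw [frobeniusTrace_7]; exact FreyRef.frey1061_noroot_13

/-- **(P6) HOLDS at `(ratPoint (2/23⁵), 17)`** (certificate `p = 7`). [cite: Mochizuki2012, IUTchIV Cor. 2.2 (ii) (P6) p.46] -/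
theorem condP6_seventeen : Cor22.CondP6 (ratPoint (((2 : ℕ) : ℚ) / (23 ^ 5 : ℕ))) 17 := by
  haveI : Fact (Nat.Prime 17) := ⟨by norm_num⟩
  haveI : Fact (Nat.Prime 7) := ⟨by norm_num⟩
  refine condP6_of_certificate 17 (by norm_num) (by norm_num) (by norm_num) 7 (by norm_num) not_dvd_Δ_7 ?_
  rw [frobeniusTrace_7]; exact FreyRef.frey1061_noroot_17

/-- **(P6) HOLDS at `(ratPoint (2/23⁵), 19)`** (certificate `p = 7`). [cite: Mochizuki2012, IUTchIV Cor. 2.2 (ii) (P6) p.46] -/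
theorem condP6_nineteen : Cor22.CondP6 (ratPoint (((2 : ℕ) : ℚ) / (23 ^ 5 : ℕ))) 19 := by
  haveI : Fact (Nat.Prime 19) := ⟨by norm_num⟩
  haveI : Fact (Nat.Prime 7) := ⟨by norm_num⟩
  refine condP6_of_certificate 19 (by norm_num) (by norm_num) (by norm_num) 7 (by norm_num) not_dvd_Δ_7 ?_
  rw [frobeniusTrace_7]; exact FreyRef.frey1061_noroot_19

/-- **(P6) at the Reyssat datum for `l ∈ {13, 17, 19}`** — the shape of W-num-6's `GenuineM.not_pilotKummerCompatHull_reyssat_le_19_rad`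
(p477727) and of w5-d236's K twin (p466042), so the M/K sockets compose with it by `hl`. [cite: Mochizuki2012, IUTchIV Cor. 2.2 (ii) (P6) p.46] -/
theorem condP6_reyssat_le_19 {l : ℕ} (hl : l = 13 ∨ l = 17 ∨ l = 19) :
    Cor22.CondP6 (ratPoint (((2 : ℕ) : ℚ) / (23 ^ 5 : ℕ))) l := by
  rcases hl with rfl | rfl | rfl
  exacts [condP6_thirteen, condP6_seventeen, condP6_nineteen]

/-! ## §5 The 25 larger `l` of the Reyssat rows `…_reyssat_of_le_149[_rad]`: `l = 29, 31, …, 149` (certificates `p = 7 / 19 / 41`) -/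

/-- `X² + 7` has no root mod `l` for the thirteen `l ∈ {31,41,47,59,61,73,83,89,97,101,103,131,139}` (`−7` a non-residue);
one kernel `decide`. [folklore] -/
theorem noroot_p7 :
    (∀ t : ZMod 31, t ^ 2 - ((0 : ℤ) : ZMod 31) * t + ((7 : ℕ) : ZMod 31) ≠ 0) ∧
    (∀ t : ZMod 41, t ^ 2 - ((0 : ℤ) : ZMod 41) * t + ((7 : ℕ) : ZMod 41) ≠ 0) ∧
    (∀ t : ZMod 47, t ^ 2 - ((0 : ℤ) : ZMod 47) * t + ((7 : ℕ) : ZMod 47) ≠ 0) ∧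
    (∀ t : ZMod 59, t ^ 2 - ((0 : ℤ) : ZMod 59) * t + ((7 : ℕ) : ZMod 59) ≠ 0) ∧
    (∀ t : ZMod 61, t ^ 2 - ((0 : ℤ) : ZMod 61) * t + ((7 : ℕ) : ZMod 61) ≠ 0) ∧
    (∀ t : ZMod 73, t ^ 2 - ((0 : ℤ) : ZMod 73) * t + ((7 : ℕ) : ZMod 73) ≠ 0) ∧
    (∀ t : ZMod 83, t ^ 2 - ((0 : ℤ) : ZMod 83) * t + ((7 : ℕ) : ZMod 83) ≠ 0) ∧
    (∀ t : ZMod 89, t ^ 2 - ((0 : ℤ) : ZMod 89) * t + ((7 : ℕ) : ZMod 89) ≠ 0) ∧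
    (∀ t : ZMod 97, t ^ 2 - ((0 : ℤ) : ZMod 97) * t + ((7 : ℕ) : ZMod 97) ≠ 0) ∧
    (∀ t : ZMod 101, t ^ 2 - ((0 : ℤ) : ZMod 101) * t + ((7 : ℕ) : ZMod 101) ≠ 0) ∧
    (∀ t : ZMod 103, t ^ 2 - ((0 : ℤ) : ZMod 103) * t + ((7 : ℕ) : ZMod 103) ≠ 0) ∧
    (∀ t : ZMod 131, t ^ 2 - ((0 : ℤ) : ZMod 131) * t + ((7 : ℕ) : ZMod 131) ≠ 0) ∧
    (∀ t : ZMod 139, t ^ 2 - ((0 : ℤ) : ZMod 139) * t + ((7 : ℕ) : ZMod 139) ≠ 0) := by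
  decide +kernel

/-- `X² + 19` has no root mod `l` for the nine `l ∈ {29,37,53,67,71,79,107,113,127}` (`−19` a non-residue); one kernel
`decide`. [folklore] -/
theorem noroot_p19 :
    (∀ t : ZMod 29, t ^ 2 - ((0 : ℤ) : ZMod 29) * t + ((19 : ℕ) : ZMod 29) ≠ 0) ∧
    (∀ t : ZMod 37, t ^ 2 - ((0 : ℤ) : ZMod 37) * t + ((19 : ℕ) : ZMod 37) ≠ 0) ∧
    (∀ t : ZMod 53, t ^ 2 - ((0 : ℤ) : ZMod 53) * t + ((19 : ℕ) : ZMod 53) ≠ 0) ∧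
    (∀ t : ZMod 67, t ^ 2 - ((0 : ℤ) : ZMod 67) * t + ((19 : ℕ) : ZMod 67) ≠ 0) ∧
    (∀ t : ZMod 71, t ^ 2 - ((0 : ℤ) : ZMod 71) * t + ((19 : ℕ) : ZMod 71) ≠ 0) ∧
    (∀ t : ZMod 79, t ^ 2 - ((0 : ℤ) : ZMod 79) * t + ((19 : ℕ) : ZMod 79) ≠ 0) ∧
    (∀ t : ZMod 107, t ^ 2 - ((0 : ℤ) : ZMod 107) * t + ((19 : ℕ) : ZMod 107) ≠ 0) ∧
    (∀ t : ZMod 113, t ^ 2 - ((0 : ℤ) : ZMod 113) * t + ((19 : ℕ) : ZMod 113) ≠ 0) ∧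
    (∀ t : ZMod 127, t ^ 2 - ((0 : ℤ) : ZMod 127) * t + ((19 : ℕ) : ZMod 127) ≠ 0) := by
  decide +kernel

/-- `X² − 2X + 41` has no root mod `l` for the three `l ∈ {43,137,149}` (`−160` a non-residue); one kernel `decide`. [folklore] -/
theorem noroot_p41 :
    (∀ t : ZMod 43, t ^ 2 - ((2 : ℤ) : ZMod 43) * t + ((41 : ℕ) : ZMod 43) ≠ 0) ∧
    (∀ t : ZMod 137, t ^ 2 - ((2 : ℤ) : ZMod 137) * t + ((41 : ℕ) : ZMod 137) ≠ 0) ∧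
    (∀ t : ZMod 149, t ^ 2 - ((2 : ℤ) : ZMod 149) * t + ((41 : ℕ) : ZMod 149) ≠ 0) := by
  decide +kernel

/-- **(P6) at the Reyssat datum for the 25 primes `29 ≤ l ≤ 149`, `l ≠ 109`, of the rows `…_reyssat_of_le_149[_rad]`** (p477727 /
p466042): certificate `p = 7` (`a₇ = 0`) for `l ∈ {31,41,47,59,61,73,83,89,97,101,103,131,139}`, `p = 19` (`a₁₉ = 0`) for
`l ∈ {29,37,53,67,71,79,107,113,127}`, `p = 41` (`a₄₁ = 2`) for `l ∈ {43,137,149}`; multiplicative prime `109`, `ord₁₀₉ Δ = 2`.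
[cite: Mochizuki2012, IUTchIV Cor. 2.2 (ii) (P6) p.46] -/
theorem condP6_reyssat_of_le_149 {l : ℕ}
    (hl : l = 29 ∨ l = 31 ∨ l = 37 ∨ l = 41 ∨ l = 43 ∨ l = 47 ∨ l = 53 ∨ l = 59 ∨ l = 61 ∨ l = 67 ∨ l = 71 ∨ l = 73 ∨ l = 79 ∨
      l = 83 ∨ l = 89 ∨ l = 97 ∨ l = 101 ∨ l = 103 ∨ l = 107 ∨ l = 113 ∨ l = 127 ∨ l = 131 ∨ l = 137 ∨ l = 139 ∨ l = 149) :
    Cor22.CondP6 (ratPoint (((2 : ℕ) : ℚ) / (23 ^ 5 : ℕ))) l := by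
  obtain ⟨n31, n41, n47, n59, n61, n73, n83, n89, n97, n101, n103, n131, n139⟩ := noroot_p7
  obtain ⟨n29, n37, n53, n67, n71, n79, n107, n113, n127⟩ := noroot_p19
  obtain ⟨n43, n137, n149⟩ := noroot_p41
  haveI : Fact (Nat.Prime 7) := ⟨by norm_num⟩
  haveI : Fact (Nat.Prime 19) := ⟨by norm_num⟩
  haveI : Fact (Nat.Prime 41) := ⟨by norm_num⟩
  rcases hl with rfl | rfl | rfl | rfl | rfl | rfl | rfl | rfl | rfl | rfl | rfl | rfl | rfl | rfl | rfl | rfl | rfl | rfl |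
    rfl | rfl | rfl | rfl | rfl | rfl | rfl
  · -- `l = 29`: `p = 19`
    haveI : Fact (Nat.Prime 29) := ⟨by norm_num⟩
    refine condP6_of_certificate 29 (by norm_num) (by norm_num) (by norm_num) 19 (by norm_num) not_dvd_Δ_19 ?_
    rw [frobeniusTrace_19]; exact n29
  · -- `l = 31`: `p = 7`
    haveI : Fact (Nat.Prime 31) := ⟨by norm_num⟩
    refine condP6_of_certificate 31 (by norm_num) (by norm_num) (by norm_num) 7 (by norm_num) not_dvd_Δ_7 ?_
    rw [frobeniusTrace_7]; exact n31
  · -- `l = 37`: `p = 19`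
    haveI : Fact (Nat.Prime 37) := ⟨by norm_num⟩
    refine condP6_of_certificate 37 (by norm_num) (by norm_num) (by norm_num) 19 (by norm_num) not_dvd_Δ_19 ?_
    rw [frobeniusTrace_19]; exact n37
  · -- `l = 41`: `p = 7`
    refine condP6_of_certificate 41 (by norm_num) (by norm_num) (by norm_num) 7 (by norm_num) not_dvd_Δ_7 ?_
    rw [frobeniusTrace_7]; exact n41
  · -- `l = 43`: `p = 41`
    haveI : Fact (Nat.Prime 43) := ⟨by norm_num⟩
    refine condP6_of_certificate 43 (by norm_num) (by norm_num) (by norm_num) 41 (by norm_num) not_dvd_Δ_41 ?_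
    rw [frobeniusTrace_41]; exact n43
  · -- `l = 47`: `p = 7`
    haveI : Fact (Nat.Prime 47) := ⟨by norm_num⟩
    refine condP6_of_certificate 47 (by norm_num) (by norm_num) (by norm_num) 7 (by norm_num) not_dvd_Δ_7 ?_
    rw [frobeniusTrace_7]; exact n47
  · -- `l = 53`: `p = 19`
    haveI : Fact (Nat.Prime 53) := ⟨by norm_num⟩
    refine condP6_of_certificate 53 (by norm_num) (by norm_num) (by norm_num) 19 (by norm_num) not_dvd_Δ_19 ?_
    rw [frobeniusTrace_19]; exact n53
  · -- `l = 59`: `p = 7`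
    haveI : Fact (Nat.Prime 59) := ⟨by norm_num⟩
    refine condP6_of_certificate 59 (by norm_num) (by norm_num) (by norm_num) 7 (by norm_num) not_dvd_Δ_7 ?_
    rw [frobeniusTrace_7]; exact n59
  · -- `l = 61`: `p = 7`
    haveI : Fact (Nat.Prime 61) := ⟨by norm_num⟩
    refine condP6_of_certificate 61 (by norm_num) (by norm_num) (by norm_num) 7 (by norm_num) not_dvd_Δ_7 ?_
    rw [frobeniusTrace_7]; exact n61
  · -- `l = 67`: `p = 19`
    haveI : Fact (Nat.Prime 67) := ⟨by norm_num⟩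
    refine condP6_of_certificate 67 (by norm_num) (by norm_num) (by norm_num) 19 (by norm_num) not_dvd_Δ_19 ?_
    rw [frobeniusTrace_19]; exact n67
  · -- `l = 71`: `p = 19`
    haveI : Fact (Nat.Prime 71) := ⟨by norm_num⟩
    refine condP6_of_certificate 71 (by norm_num) (by norm_num) (by norm_num) 19 (by norm_num) not_dvd_Δ_19 ?_
    rw [frobeniusTrace_19]; exact n71
  · -- `l = 73`: `p = 7`
    haveI : Fact (Nat.Prime 73) := ⟨by norm_num⟩
    refine condP6_of_certificate 73 (by norm_num) (by norm_num) (by norm_num) 7 (by norm_num) not_dvd_Δ_7 ?_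
    rw [frobeniusTrace_7]; exact n73
  · -- `l = 79`: `p = 19`
    haveI : Fact (Nat.Prime 79) := ⟨by norm_num⟩
    refine condP6_of_certificate 79 (by norm_num) (by norm_num) (by norm_num) 19 (by norm_num) not_dvd_Δ_19 ?_
    rw [frobeniusTrace_19]; exact n79
  · -- `l = 83`: `p = 7`
    haveI : Fact (Nat.Prime 83) := ⟨by norm_num⟩
    refine condP6_of_certificate 83 (by norm_num) (by norm_num) (by norm_num) 7 (by norm_num) not_dvd_Δ_7 ?_
    rw [frobeniusTrace_7]; exact n83
  · -- `l = 89`: `p = 7`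
    haveI : Fact (Nat.Prime 89) := ⟨by norm_num⟩
    refine condP6_of_certificate 89 (by norm_num) (by norm_num) (by norm_num) 7 (by norm_num) not_dvd_Δ_7 ?_
    rw [frobeniusTrace_7]; exact n89
  · -- `l = 97`: `p = 7`
    haveI : Fact (Nat.Prime 97) := ⟨by norm_num⟩
    refine condP6_of_certificate 97 (by norm_num) (by norm_num) (by norm_num) 7 (by norm_num) not_dvd_Δ_7 ?_
    rw [frobeniusTrace_7]; exact n97
  · -- `l = 101`: `p = 7`
    haveI : Fact (Nat.Prime 101) := ⟨by norm_num⟩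
    refine condP6_of_certificate 101 (by norm_num) (by norm_num) (by norm_num) 7 (by norm_num) not_dvd_Δ_7 ?_
    rw [frobeniusTrace_7]; exact n101
  · -- `l = 103`: `p = 7`
    haveI : Fact (Nat.Prime 103) := ⟨by norm_num⟩
    refine condP6_of_certificate 103 (by norm_num) (by norm_num) (by norm_num) 7 (by norm_num) not_dvd_Δ_7 ?_
    rw [frobeniusTrace_7]; exact n103
  · -- `l = 107`: `p = 19`
    haveI : Fact (Nat.Prime 107) := ⟨by norm_num⟩
    refine condP6_of_certificate 107 (by norm_num) (by norm_num) (by norm_num) 19 (by norm_num) not_dvd_Δ_19 ?_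
    rw [frobeniusTrace_19]; exact n107
  · -- `l = 113`: `p = 19`
    haveI : Fact (Nat.Prime 113) := ⟨by norm_num⟩
    refine condP6_of_certificate 113 (by norm_num) (by norm_num) (by norm_num) 19 (by norm_num) not_dvd_Δ_19 ?_
    rw [frobeniusTrace_19]; exact n113
  · -- `l = 127`: `p = 19`
    haveI : Fact (Nat.Prime 127) := ⟨by norm_num⟩
    refine condP6_of_certificate 127 (by norm_num) (by norm_num) (by norm_num) 19 (by norm_num) not_dvd_Δ_19 ?_
    rw [frobeniusTrace_19]; exact n127
  · -- `l = 131`: `p = 7`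
    haveI : Fact (Nat.Prime 131) := ⟨by norm_num⟩
    refine condP6_of_certificate 131 (by norm_num) (by norm_num) (by norm_num) 7 (by norm_num) not_dvd_Δ_7 ?_
    rw [frobeniusTrace_7]; exact n131
  · -- `l = 137`: `p = 41`
    haveI : Fact (Nat.Prime 137) := ⟨by norm_num⟩
    refine condP6_of_certificate 137 (by norm_num) (by norm_num) (by norm_num) 41 (by norm_num) not_dvd_Δ_41 ?_
    rw [frobeniusTrace_41]; exact n137
  · -- `l = 139`: `p = 7`
    haveI : Fact (Nat.Prime 139) := ⟨by norm_num⟩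
    refine condP6_of_certificate 139 (by norm_num) (by norm_num) (by norm_num) 7 (by norm_num) not_dvd_Δ_7 ?_
    rw [frobeniusTrace_7]; exact n139
  · -- `l = 149`: `p = 41`
    haveI : Fact (Nat.Prime 149) := ⟨by norm_num⟩
    refine condP6_of_certificate 149 (by norm_num) (by norm_num) (by norm_num) 41 (by norm_num) not_dvd_Δ_41 ?_
    rw [frobeniusTrace_41]; exact n149

end FreyP6Reyssat

end Summit.ABC.IUTFork.Conditional

end
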